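import Summits.CriticalPhenomena.PercolationContinuityZ3.Theses.PercNearOneGluing
import Literature.Probability.Percolation.FourFunctionsProdBernoulli
import Literature.Probability.Percolation.FoldingFibres
import HarnessLib

/-! # Crux `PercNearOneGluing.AdditiveGluing` (stmt-CriticalPhenomena-4576) — the four-functions route at the observer's star

Support file (`--supports stmt-CriticalPhenomena-4576`, cell `prim-png-dp-al5` gen 7; memo `EXPLORE-g7.md` §7).  No `sorry`, no definitions.

Decompose by the STAR of the observer: `star o ω = {v ≠ o : s(o,v) ∈ ω}` (the open neighbours of `o`), cells `D_S = {star = S}`.  The law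
of the star is log-modular (product measure), so the Ahlswede–Daykin four functions theorem (tree: `prodBernoulli_fourFunctions`) applied to
the three CONDITIONAL probabilities given the star yields:

* `StarAD.conj1_of_starCond` — if for one relay `x ∈ A` and all `S, T ∌ o`
  `μ(o ↔ A | D_S) · μ(x ↔ b | D_T) ≤ μ(o ↔ b | D_{S ∪ T})`   (conditional probabilities written as quotients, `0` on null cells)   (COND)
  then `μ(o ↔ A) · μ(x ↔ b) ≤ μ(o ↔ b)` — Kozma–Nitzan's Conjecture 1 with the relay `x` (census designee: `x = a₉`, the least `b`-reliable relay
  of `G − o`, Kozma–Nitzan's Question 9; 0 violations found, memo §7);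
* `StarAD.additiveGluing_of_starCond` — (COND for every instance) ⇒ `AdditiveGluing`.
[cite: KozmaNitzan2024, Conjecture 1 (p. 3), Question 9 (p. 36); BollobasRiordan2006, Ch. 2 Thm. 7 (four functions); AhlswedeDaykin1978]
-/

namespace Summit.CriticalPhenomena.PercolationContinuityZ3.Theorems

open MeasureTheory Set
open Literature.Probability.LatticeModels (prodBernoulli)
open Literature.Probability.Percolation
open Literature.Probability.Percolation.BHK2006 Literature.Probability.Percolation.DecisionTree
open scoped BigOperators

noncomputable section
open Classical

namespace StarAD

variable {V : Type*} [Fintype V]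

omit [Fintype V] in
/-- The star cell of `ω`: the set of open neighbours of `o`. (Local notation only; no definition is introduced —
we work with the function `fun ω => {v | v ≠ o ∧ s(o, v) ∈ ω}` inline.) [folklore] -/
theorem star_union (o : V) (ω ω' : BondConfig V) :
    {v : V | v ≠ o ∧ s(o, v) ∈ ω ∪ ω'} = {v | v ≠ o ∧ s(o, v) ∈ ω} ∪ {v | v ≠ o ∧ s(o, v) ∈ ω'} := by
  ext v
  simp only [mem_setOf_eq, mem_union]
  tauto

/-- **Disintegration over the star.**  For any event `E` and the quotient function
`q S = μ(E ∩ D_S) / μ(D_S)` (`= 0` on null cells, by `x / 0 = 0`), `∫ q(star ω) dμ = μ(E)`. [folklore] -/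
theorem integral_quot_star (w : Sym2 V → unitInterval) (o : V) (E : Set (BondConfig V)) :
    ∫ ω, (fun S : Set V => (prodBernoulli w).real (E ∩ {ω' | {v : V | v ≠ o ∧ s(o, v) ∈ ω'} = S}) /
        (prodBernoulli w).real {ω' | {v : V | v ≠ o ∧ s(o, v) ∈ ω'} = S})
      {v : V | v ≠ o ∧ s(o, v) ∈ ω} ∂(prodBernoulli w) = (prodBernoulli w).real E := by
  classical
  set μ := prodBernoulli w with hμ
  set st : BondConfig V → Set V := fun ω => {v : V | v ≠ o ∧ s(o, v) ∈ ω} with hst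
  set D : Set V → Set (BondConfig V) := fun S => {ω' | st ω' = S} with hD
  set q : Set V → ℝ := fun S => μ.real (E ∩ D S) / μ.real (D S) with hq
  change ∫ ω, q (st ω) ∂μ = μ.real E
  -- point-mass expansions
  rw [hμ, integral_prodBernoulli_eq_sum]
  set wt : BondConfig V → ℝ := weight (fun e => (w e : ℝ)) with hwt
  -- group the configurations by their star
  have hgroup : ∑ ω : BondConfig V, wt ω * q (st ω) =
      ∑ S : Set V, q S * ∑ ω ∈ (Finset.univ : Finset (BondConfig V)).filter (fun ω => st ω = S), wt ω := by
    rw [← Finset.sum_fiberwise_of_maps_to (s := (Finset.univ : Finset (BondConfig V))) (t := (Finset.univ : Finset (Set V)))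
      (g := st) (fun _ _ => Finset.mem_univ _)]
    refine Finset.sum_congr rfl fun S _ => ?_
    rw [Finset.mul_sum]
    refine Finset.sum_congr rfl fun ω hω => ?_
    rw [Finset.mem_filter] at hω
    rw [hω.2, mul_comm]
  -- the inner sums are the cell masses
  have hcell : ∀ S : Set V, ∑ ω ∈ (Finset.univ : Finset (BondConfig V)).filter (fun ω => st ω = S), wt ω =
      (prodBernoulli w).real (D S) := by
    intro S
    rw [prodBernoulli_real_eq_sum_weight_ind, Finset.sum_filter]
    refine Finset.sum_congr rfl fun ω _ => ?_
    by_cases h : st ω = S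
    · rw [if_pos h, ind_of_mem (show ω ∈ D S from h), mul_one]
    · rw [if_neg h, ind_of_not_mem (show ω ∉ D S from h), mul_zero]
  rw [hgroup]
  simp_rw [hcell]
  -- `q S · μ(D_S) = μ(E ∩ D_S)` (also on null cells)
  have hqS : ∀ S : Set V, q S * (prodBernoulli w).real (D S) = (prodBernoulli w).real (E ∩ D S) := by
    intro S
    by_cases h0 : (prodBernoulli w).real (D S) = 0
    · have : (prodBernoulli w).real (E ∩ D S) = 0 :=
        le_antisymm ((measureReal_mono inter_subset_right).trans h0.le) measureReal_nonneg
      rw [h0, mul_zero, this]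
    · rw [hq]; exact div_mul_cancel₀ _ h0
  simp_rw [hqS]
  -- the cells partition the space
  have hdisj : ∀ S T : Set V, S ≠ T → Disjoint (E ∩ D S) (E ∩ D T) := by
    intro S T hST
    rw [Set.disjoint_left]
    rintro ω ⟨_, hS⟩ ⟨_, hT⟩
    exact hST (hS.symm.trans hT)
  have hcover : E = ⋃ S : Set V, (E ∩ D S) := by
    ext ω
    simp only [mem_iUnion, mem_inter_iff]
    exact ⟨fun h => ⟨st ω, h, rfl⟩, fun ⟨_, h, _⟩ => h⟩
  rw [← hμ]
  conv_rhs => rw [hcover]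
  rw [measureReal_iUnion_fintype (fun S T hST => hdisj S T hST) (fun _ => MeasurableSet.of_discrete)]

/-- **Conjecture 1 from the star condition (COND), by the four functions theorem.**  If for a relay `x` and all `S, T ∌ o`
`μ(o ↔ A | D_S) μ(x ↔ b | D_T) ≤ μ(o ↔ b | D_{S∪T})` (quotient convention `·/0 = 0`), then `μ(o ↔ A) · μ(x ↔ b) ≤ μ(o ↔ b)`.
Proof: Ahlswede–Daykin for `prodBernoulli w` with `f₁ = q_{o↔A} ∘ star`, `f₂ = q_{x↔b} ∘ star`, `f₃ = 1`, `f₄ = q_{o↔b} ∘ star`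
(`star(ω ∪ ω') = star ω ∪ star ω'`), and the disintegration `∫ q_E ∘ star = μ(E)`.
[cite: BollobasRiordan2006, Ch. 2 Thm. 7; KozmaNitzan2024, Conjecture 1 (p. 3)] -/
theorem conj1_of_starCond (w : Sym2 V → unitInterval) (A : Finset V) (o b x : V)
    (hC : ∀ S T : Set V, o ∉ S → o ∉ T →
      ((prodBernoulli w).real ((⋃ a ∈ A, openConn o a) ∩ {ω' | {v : V | v ≠ o ∧ s(o, v) ∈ ω'} = S}) /
          (prodBernoulli w).real {ω' | {v : V | v ≠ o ∧ s(o, v) ∈ ω'} = S}) *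
        ((prodBernoulli w).real (openConn x b ∩ {ω' | {v : V | v ≠ o ∧ s(o, v) ∈ ω'} = T}) /
          (prodBernoulli w).real {ω' | {v : V | v ≠ o ∧ s(o, v) ∈ ω'} = T}) ≤
        (prodBernoulli w).real (openConn o b ∩ {ω' | {v : V | v ≠ o ∧ s(o, v) ∈ ω'} = S ∪ T}) /
          (prodBernoulli w).real {ω' | {v : V | v ≠ o ∧ s(o, v) ∈ ω'} = S ∪ T}) :
    (prodBernoulli w).real (⋃ a ∈ A, openConn o a) * (prodBernoulli w).real (openConn x b) ≤
      (prodBernoulli w).real (openConn o b) := by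
  classical
  set μ := prodBernoulli w with hμ
  set st : BondConfig V → Set V := fun ω => {v : V | v ≠ o ∧ s(o, v) ∈ ω} with hst
  set D : Set V → Set (BondConfig V) := fun S => {ω' | st ω' = S} with hD
  set qA : Set V → ℝ := fun S => μ.real ((⋃ a ∈ A, openConn o a) ∩ D S) / μ.real (D S) with hqA
  set qX : Set V → ℝ := fun S => μ.real (openConn x b ∩ D S) / μ.real (D S) with hqX
  set qB : Set V → ℝ := fun S => μ.real (openConn o b ∩ D S) / μ.real (D S) with hqB
  have hnn : ∀ (E : Set (BondConfig V)) (S : Set V), 0 ≤ μ.real (E ∩ D S) / μ.real (D S) :=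
    fun E S => div_nonneg measureReal_nonneg measureReal_nonneg
  have hsto : ∀ ω : BondConfig V, o ∉ st ω := fun ω h => h.1 rfl
  have AD := prodBernoulli_fourFunctions (ι := Sym2 V) w (fun ω => qA (st ω)) (fun ω => qX (st ω))
    (fun _ => (1 : ℝ)) (fun ω => qB (st ω))
    (fun ω => hnn _ _) (fun ω => hnn _ _) (fun _ => zero_le_one) (fun ω => hnn _ _)
    (fun ω ω' => by
      have hu : st (ω ∪ ω') = st ω ∪ st ω' := star_union o ω ω'
      rw [one_mul, hu]
      exact hC (st ω) (st ω') (hsto ω) (hsto ω'))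
  have h1 : ∫ ω, qA (st ω) ∂μ = μ.real (⋃ a ∈ A, openConn o a) := integral_quot_star w o _
  have h2 : ∫ ω, qX (st ω) ∂μ = μ.real (openConn x b) := integral_quot_star w o _
  have h4 : ∫ ω, qB (st ω) ∂μ = μ.real (openConn o b) := integral_quot_star w o _
  have h3 : ∫ _ω, (1 : ℝ) ∂μ = 1 := by
    rw [integral_const, smul_eq_mul, mul_one, probReal_univ]
  rw [h1, h2, h3, h4, one_mul] at AD
  exact AD

end StarAD

/-- **(COND) ⇒ `AdditiveGluing`.**  If every instance with `o ∉ A`, `o ≠ b`, `A ≠ ∅` (`b ∈ A` allowed: then Conjecture 1 for `A` is the failure bound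
for `A ∖ {b}`) admits a relay `x ∈ A` satisfying the star condition (COND) of `StarAD.conj1_of_starCond` (census designee: the least `b`-reliable relay of
`G − o` among `A ∖ {b}`), then the crux decl holds: `μ(o ↔ A) − t ≤ μ(o ↔ A)(1 − t) ≤ μ(o ↔ A) μ(x ↔ b) ≤ μ(o ↔ b)`.
[cite: KozmaNitzan2024, Conjecture 1 (p. 3), Question 9 (p. 36)] -/
theorem StarAD.additiveGluing_of_starCond
    (hC : ∀ (n : ℕ) (w : Sym2 (Fin n) → unitInterval) (A : Finset (Fin n)) (o b : Fin n),
      o ∉ A → o ≠ b → A.Nonempty → ∃ x ∈ A, ∀ S T : Set (Fin n), o ∉ S → o ∉ T →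
        ((prodBernoulli w).real ((⋃ a ∈ A, openConn o a) ∩ {ω' | {v : Fin n | v ≠ o ∧ s(o, v) ∈ ω'} = S}) /
            (prodBernoulli w).real {ω' | {v : Fin n | v ≠ o ∧ s(o, v) ∈ ω'} = S}) *
          ((prodBernoulli w).real (openConn x b ∩ {ω' | {v : Fin n | v ≠ o ∧ s(o, v) ∈ ω'} = T}) /
            (prodBernoulli w).real {ω' | {v : Fin n | v ≠ o ∧ s(o, v) ∈ ω'} = T}) ≤
          (prodBernoulli w).real (openConn o b ∩ {ω' | {v : Fin n | v ≠ o ∧ s(o, v) ∈ ω'} = S ∪ T}) /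
            (prodBernoulli w).real {ω' | {v : Fin n | v ≠ o ∧ s(o, v) ∈ ω'} = S ∪ T}) :
    Theses.PercNearOneGluing.AdditiveGluing := by
  classical
  intro n w A o b t ht hrel
  set μ := prodBernoulli w with hμ
  set OA : Set (BondConfig (Fin n)) := ⋃ a ∈ A, openConn o a with hOA
  have hOA1 : μ.real OA ≤ 1 := measureReal_le_one
  have hOA0 : 0 ≤ μ.real OA := measureReal_nonneg
  have hob0 : 0 ≤ μ.real (openConn o b : Set (BondConfig (Fin n))) := measureReal_nonneg
  by_cases hAe : A = ∅
  · have h0 : μ.real OA = 0 := by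
      have : OA = ∅ := by ext ω; simp [hOA, hAe]
      rw [this, measureReal_empty]
    rw [h0]; linarith
  have hAne : A.Nonempty := Finset.nonempty_iff_ne_empty.2 hAe
  by_cases hoA : o ∈ A
  · have h1 := hrel o hoA
    linarith
  by_cases hob : o = b
  · subst hob
    have h1 : μ.real (openConn o o : Set (BondConfig (Fin n))) = 1 := by
      have : (openConn o o : Set (BondConfig (Fin n))) = univ := by
        ext ω; exact ⟨fun _ => trivial, fun _ => SimpleGraph.Reachable.refl _⟩
      rw [this]; exact probReal_univ
    rw [h1]; linarith
  obtain ⟨x, hx, hCx⟩ := hC n w A o b hoA hob hAne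
  have c1 := StarAD.conj1_of_starCond w A o b x hCx
  have hxr := hrel x hx
  nlinarith [mul_le_mul_of_nonneg_left hxr hOA0]

end

end Summit.CriticalPhenomena.PercolationContinuityZ3.Theorems
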